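import Literature.Geometry.Riemannian.EellsSampsonModelReduction
import Literature.Geometry.Riemannian.HeatFlowEnergy
import Literature.Geometry.Manifold.HomotopyClassesOpen
import HarnessLib

/-!
# The Eells–Sampson theorem: decomposition into the two theorems of the heat-flow proof
(topic `Geometry/Riemannian`)

Fact-decomposition file (librarian, mode `fact-decompose`, 2026-08-16) for the named fact
`Literature.Geometry.Riemannian.eellsSampson_existence` (`EellsSampson.lean`; J. Eells,
J. H. Sampson, *Harmonic mappings of Riemannian manifolds*, Amer. J. Math. 86 (1964) 109–160,
§11 Thm.; Carlson–Müller-Stach–Peters 2017, Thm. 14.1.3). The tree already PROVES the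
differential-geometric, variational, topological and model-change layers
(`eellsSampson_existence_of_tensionField_solvable`, `EellsSampsonModelReduction.lean`: the fact
follows from the solvability of `τ(φ) = 0` in every smooth homotopy class of maps from compact
`ℝ^m`-charted Riemannian manifolds into compact nonpositively curved targets). The printed proof
of that solvability is the heat flow `∂ₜu = τ(u_t)` (Eells–Sampson 1964, §6 (1)), in two theorems:

* **global existence** (§10, Thm. 10 C with §6 (C) and §7: for `N` compact with Riemannian
  curvature `≤ 0`, the heat equation with `C^∞` initial map `f` has a solution `u` for all
  `t ≥ 0`, continuous on `[0, ∞) × M` with `u(0, ·) = f` and `C^∞` for `t > 0`) — child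
  `eellsSampson_heatFlow_globalExistence`;
* **subconvergence to a harmonic map** (§10 Cor. and §11, proof of Thm. 11 A: along a suitable
  sequence `t_k → ∞` the maps `u(t_k, ·)` converge uniformly, with their derivatives, to a `C^∞`
  map `φ` with `τ(φ) = 0`; by §6 (B) the energy is non-increasing, `HeatFlowEnergy.lean`) —
  child `eellsSampson_heatFlow_subconvergence` (only uniform convergence, i.e. convergence in
  `C(M, N)`, is vended).

`eellsSampson_existence_holds_of` PROVES the parent from the two children: the flow itself is a
homotopy `f ≃ u(t_k, ·)` (`ContinuousMap.Homotopy` with `H(s, x) = u(s t_k, x)`), a limit in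
`C(M, N)` of maps homotopic to `f` is homotopic to `f` (`ContinuousMap.Homotopic.of_tendsto`,
`HomotopyClassesOpen.lean`; Lee 2013, Prop. 6.25), and `eellsSampson_existence_of_tensionField_solvable`
concludes. Neither child restates the parent (the first produces no harmonic map, the second
assumes a global flow). Vocabulary: `HarmonicMap.tensionField` (`TensionField.lean`),
`Lorentzian.velocity` (`∂ₜ` of the curve `t ↦ u(t, x)`, `Geodesic.lean`), exactly as in
`HeatFlowEnergy.lean`.

## References

* J. Eells, J. H. Sampson, Amer. J. Math. 86 (1964): §6 (1), (B), (C); §7; §10 Thm. 10 C and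
  Cor.; §11 Thm. 11 A and its proof. [EellsSampson1964]
* J. Carlson, S. Müller-Stach, C. Peters, *Period Mappings and Period Domains*, 2nd ed. (2017),
  §14.1, Thm. 14.1.3 and proof sketch (p. 346). [CarlsonMullerStachPeters2017]
* P. Hartman, *On homotopic harmonic maps*, Canad. J. Math. 19 (1967) 673–687 (full convergence
  `u(t, ·) → φ`; not needed here).
* J. M. Lee, *Introduction to Smooth Manifolds*, 2nd ed. (2013), Prop. 6.25. [LeeSmoothManifolds2013]
-/

noncomputable section

open Bundle Set Function Filter
open scoped Manifold ContDiff Topology unitInterval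

namespace Literature.Geometry.Riemannian

open Lorentzian Lorentzian.PseudoRiemannianMetric HarmonicMap

/-- **Eells–Sampson 1964, §10 (global existence of the heat flow into nonpositively curved
targets; child 1 of `eellsSampson_existence`).** "If `M'` [= `N`] has non-positive Riemannian
curvature, then the heat equation (1) [`∂u/∂t = τ(u)`] with any `C^∞` initial map `f` has a
solution defined for all `t ≥ 0`" (§10, Thm. 10 C with §6 (C), §7, for `M`, `N` compact). Lean
form, for a compact `C^∞` manifold `M` charted on `ℝ^m` with a `C^∞` Riemannian metric `g`, a
compact boundaryless `C^∞` manifold `N` with a `C^∞` Riemannian metric `h` of nonpositive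
sectional curvature, and a `C^∞` map `f : M → N`: there is `u : ℝ → M → N` (values for `t < 0`
irrelevant) which is continuous on `[0, ∞) × M`, of class `C^∞` on `(0, ∞) × M`, with
`u 0 = f` and `∂ₜu(t, x) = τ(u(t, ·))(x)` for all `t > 0`, `x ∈ M` (`Lorentzian.velocity` of the
curve `t ↦ u t x`, `HarmonicMap.tensionField`). [cite: EellsSampson1964, §10 Thm. 10 C (with §6 (C), §7)] -/
def eellsSampson_heatFlow_globalExistence : Prop :=
  ∀ (m : ℕ) (M : Type) [TopologicalSpace M] [ChartedSpace (EuclideanSpace ℝ (Fin m)) M]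
    [IsManifold (𝓡 m) ∞ M] [CompactSpace M] [T3Space M] [MeasurableSpace M] [BorelSpace M]
    (EN : Type) [NormedAddCommGroup EN] [NormedSpace ℝ EN] [FiniteDimensional ℝ EN]
    [CompleteSpace EN] (HN : Type) [TopologicalSpace HN] (IN : ModelWithCorners ℝ EN HN)
    (N : Type) [TopologicalSpace N] [ChartedSpace HN N] [IsManifold IN ∞ N]
    [BoundarylessManifold IN N] [T2Space N] [CompactSpace N]
    (g : ContMDiffRiemannianMetric (𝓡 m) ∞ (EuclideanSpace ℝ (Fin m))
      (TangentSpace (𝓡 m) : M → Type _)) [(ofRiemannian g).HasLeviCivita]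
    (h : PseudoRiemannianMetric IN ∞ EN (TangentSpace IN : N → Type _)) [h.HasLeviCivita],
    h.IsRiemannian → h.HasNonposSectionalCurvature →
      ∀ (f : M → N), ContMDiff (𝓡 m) IN ∞ f →
        ∃ u : ℝ → M → N,
          ContinuousOn (fun p : ℝ × M => u p.1 p.2) (Ici 0 ×ˢ univ) ∧
          ContMDiffOn (𝓘(ℝ, ℝ).prod (𝓡 m)) IN ∞ (fun p : ℝ × M => u p.1 p.2) (Ioi 0 ×ˢ univ) ∧
          u 0 = f ∧
          ∀ t : ℝ, 0 < t → ∀ x : M, velocity IN (fun s => u s x) t = tensionField g h (u t) x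

/-- **Eells–Sampson 1964, §§10–11 (subconvergence of the heat flow to a harmonic map; child 2
of `eellsSampson_existence`).** §10 Cor. and the proof of Thm. 11 A: for `M`, `N` compact and `N`
of nonpositive Riemannian curvature, a global solution `u` of `∂ₜu = τ(u_t)` (continuous on
`[0, ∞) × M`, `C^∞` for `t > 0`) has uniformly bounded energy density and "there is a sequence
`t₁ < t₂ < ⋯ → ∞` such that the maps `u(·, t_k)` converge uniformly, together with their
space derivatives of all orders, to a harmonic map". Lean form (data as in child 1): there are a
`C^∞` map `φ : M → N` with `τ(φ) ≡ 0`, positive times `t_k → ∞`, and continuity witnesses for the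
`u(t_k, ·)`, such that `u(t_k, ·) → φ` in `C(M, N)` (compact-open topology, i.e. uniformly); the
convergence of derivatives is not restated. [cite: EellsSampson1964, §10 Cor. and §11 Thm. 11 A (proof)] -/
def eellsSampson_heatFlow_subconvergence : Prop :=
  ∀ (m : ℕ) (M : Type) [TopologicalSpace M] [ChartedSpace (EuclideanSpace ℝ (Fin m)) M]
    [IsManifold (𝓡 m) ∞ M] [CompactSpace M] [T3Space M] [MeasurableSpace M] [BorelSpace M]
    (EN : Type) [NormedAddCommGroup EN] [NormedSpace ℝ EN] [FiniteDimensional ℝ EN]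
    [CompleteSpace EN] (HN : Type) [TopologicalSpace HN] (IN : ModelWithCorners ℝ EN HN)
    (N : Type) [TopologicalSpace N] [ChartedSpace HN N] [IsManifold IN ∞ N]
    [BoundarylessManifold IN N] [T2Space N] [CompactSpace N]
    (g : ContMDiffRiemannianMetric (𝓡 m) ∞ (EuclideanSpace ℝ (Fin m))
      (TangentSpace (𝓡 m) : M → Type _)) [(ofRiemannian g).HasLeviCivita]
    (h : PseudoRiemannianMetric IN ∞ EN (TangentSpace IN : N → Type _)) [h.HasLeviCivita],
    h.IsRiemannian → h.HasNonposSectionalCurvature →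
      ∀ (u : ℝ → M → N),
        ContinuousOn (fun p : ℝ × M => u p.1 p.2) (Ici 0 ×ˢ univ) →
        ContMDiffOn (𝓘(ℝ, ℝ).prod (𝓡 m)) IN ∞ (fun p : ℝ × M => u p.1 p.2) (Ioi 0 ×ˢ univ) →
        (∀ t : ℝ, 0 < t → ∀ x : M, velocity IN (fun s => u s x) t = tensionField g h (u t) x) →
        ∃ (φ : M → N) (hφ : ContMDiff (𝓡 m) IN ∞ φ) (t : ℕ → ℝ)
          (hcont : ∀ k, Continuous (u (t k))),
          (∀ x, tensionField g h φ x = 0) ∧ (∀ k, 0 < t k) ∧ Tendsto t atTop atTop ∧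
          Tendsto (fun k => (⟨u (t k), hcont k⟩ : C(M, N))) atTop (𝓝 ⟨φ, hφ.continuous⟩)

/-- The heat flow is a homotopy: if `u` is continuous on `[0, ∞) × M` with `u 0 = f`, then for
every `T > 0` the map `f` is homotopic to `u T` through `H(s, x) = u(sT, x)`. [folklore] -/
theorem homotopic_of_continuousOn_flow {M N : Type*} [TopologicalSpace M] [TopologicalSpace N]
    {u : ℝ → M → N} (hu : ContinuousOn (fun p : ℝ × M => u p.1 p.2) (Ici 0 ×ˢ univ))
    {f : M → N} (hf : Continuous f) (h0 : u 0 = f) {T : ℝ} (hT : 0 < T)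
    (hT' : Continuous (u T)) :
    (⟨f, hf⟩ : C(M, N)).Homotopic ⟨u T, hT'⟩ := by
  have hcont : Continuous fun p : I × M => u ((p.1 : ℝ) * T) p.2 := by
    have hmap : Continuous fun p : I × M => (((p.1 : ℝ) * T), p.2) := by fun_prop
    refine (hu.comp_continuous hmap fun p => ?_)
    exact ⟨mul_nonneg p.1.2.1 hT.le, mem_univ _⟩
  refine ⟨{ toFun := fun p => u ((p.1 : ℝ) * T) p.2
            continuous_toFun := hcont
            map_zero_left := fun x => by simp [h0]
            map_one_left := fun x => by simp }⟩

/-- **Assembly (PROVED): the Eells–Sampson theorem from the two heat-flow theorems.** For smooth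
`f`, run the global flow (child 1), extract `t_k → ∞` with `u(t_k, ·) → φ`, `τ(φ) = 0` (child 2);
`f ≃ u(t_k, ·)` along the flow and homotopy classes are closed under limits in `C(M, N)`
(`ContinuousMap.Homotopic.of_tendsto`), so `φ ≃ f`; conclude by
`eellsSampson_existence_of_tensionField_solvable` (Whitney approximation, first variation, model
change). This is the printed proof, Eells–Sampson 1964, §11 Thm. 11 A / CMP 2017, p. 346.
[cite: EellsSampson1964, §11 Thm. 11 A] [cite: CarlsonMullerStachPeters2017, Thm. 14.1.3 (proof sketch, p. 346)] -/
theorem eellsSampson_existence_holds_of (hex : eellsSampson_heatFlow_globalExistence)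
    (hconv : eellsSampson_heatFlow_subconvergence) : eellsSampson_existence := by
  refine eellsSampson_existence_of_tensionField_solvable ?_
  intro m M _ _ _ _ _ _ _ EN _ _ _ _ HN _ IN N _ _ _ _ _ _ g _ h _ hR hK f hf
  obtain ⟨u, hu0, husm, hinit, hflow⟩ := hex m M EN HN IN N g h hR hK f hf
  obtain ⟨φ, hφ, t, hcont, hτ, htpos, -, hlim⟩ :=
    hconv m M EN HN IN N g h hR hK u hu0 husm hflow
  refine ⟨φ, hφ, hτ, ?_⟩
  have hF : ∀ k, (⟨u (t k), hcont k⟩ : C(M, N)).Homotopic ⟨f, hf.continuous⟩ := fun k =>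
    (homotopic_of_continuousOn_flow hu0 hf.continuous hinit (htpos k) (hcont k)).symm
  exact (ContinuousMap.Homotopic.of_tendsto (IN := IN) hF hlim).symm

end Literature.Geometry.Riemannian

end
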